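import Summits.KontsevichZagierPeriods.KontsevichZagierPeriods.Theses.FurushoPentagon

/-!
# `ReducedPeriodRing`, line `effective-end-monoid`: the cubical effective sub-calculus (definitions)

Definitions for the crux `FurushoPentagon.ReducedPeriodRing` (stmt-KontsevichZagierPeriods-3929),
line `effective-end-monoid` (lead prover). The line stays EFFECTIVE: it compiles every integral
representation of the Kontsevich–Zagier calculus (`KZ.IntegralRep`, [Kontsevich–Zagier 2001, §1.1])
to *tame cube classes* — representations on the closed unit cube `[0,1]ⁿ` whose integrand is real
analytic on a neighbourhood of the cube (the shape of the generators of Ayoub's presentation of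
effective periods, [Ayoub 2014, Def. 6 / Prop. 11], and of [Huber–Müller-Stach 2017, §12.1]) — and
works in the sub-calculus generated by four CUBICAL move families (integrand additivity on the
cube, Newton–Leibniz along the last coordinate of the cube with an analytic primitive, analytic
`ℚ`-semialgebraic diffeomorphisms of the cube, dyadic halving of one coordinate). The cubical
effective algebra is `A_□ := ℤ[tame cube classes] ⧸ cubeRelations`; the line's stubs say that
`A_□ → KZ.FormalRep ⧸ KZ.relations` is an isomorphism (compilation, soundness, coherence) and that
`A_□` has no square roots of zero, which together give the crux.

## Main definitions (namespace `Summit.KontsevichZagierPeriods.FurushoPentagon.ReducedPeriodRing`)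

* `unitCube n` — the closed unit cube `{x : ℝⁿ | ∀ i, 0 ≤ x i ≤ 1}`;
* `cubicalGens` — the generators `[r]` of `KZ.FormalRep` with `r.domain = unitCube n` and
  `r.integrand` analytic on a neighbourhood of every point of the cube (`AnalyticOnNhd`);
  `cubicalSpan` — the subgroup they generate;
* `cubeIntegrandAddRel`, `cubeNewtonLeibnizRel`, `cubeChangeOfVariablesRel`, `cubeHalvingRel` —
  the four cubical move families; `cubeMoves` their union; `cubeRelations` the subgroup generated.

## References

* M. Kontsevich, D. Zagier, *Periods*, in: Mathematics Unlimited — 2001 and Beyond (2001), §1.2.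
* J. Ayoub, *Periods and the conjectures of Grothendieck and Kontsevich–Zagier*, EMS Newsl. 91
  (2014), Def. 6, Prop. 11, Rem. 12.
* A. Huber, S. Müller-Stach, *Periods and Nori Motives*, Springer (2017), §12.1, §13.1.
-/

noncomputable section

namespace Summit.KontsevichZagierPeriods.FurushoPentagon.ReducedPeriodRing

open Set
open Literature.NumberTheory.Transcendental Literature.NumberTheory.Transcendental.KZ

/-- The closed unit cube `[0,1]ⁿ = {x : ℝⁿ | ∀ i, 0 ≤ x i ≤ 1}`.
[Kontsevich–Zagier 2001, §1.1; Ayoub 2014, Def. 6] -/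
def unitCube (n : ℕ) : Set (Fin n → ℝ) := {x | ∀ i, 0 ≤ x i ∧ x i ≤ 1}

/-- Membership in the unit cube. [folklore] -/
@[simp] theorem mem_unitCube {n : ℕ} (x : Fin n → ℝ) : x ∈ unitCube n ↔ ∀ i, 0 ≤ x i ∧ x i ≤ 1 :=
  Iff.rfl

/-- The *tame cube classes*: generators `[r]` of `KZ.FormalRep` whose domain is the closed unit
cube and whose integrand is real analytic on a neighbourhood of each point of the cube.
[Ayoub 2014, Def. 6 (generators of `P^eff_KZ`); Huber–Müller-Stach 2017, §12.1] -/
def cubicalGens : Set FormalRep :=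
  {d | ∃ (n : ℕ) (r : IntegralRep n),
    r.domain = unitCube n ∧ AnalyticOnNhd ℝ r.integrand (unitCube n) ∧ d = of r}

/-- The subgroup of `KZ.FormalRep` generated by the tame cube classes (`ℤ[tame cube classes]`).
[Ayoub 2014, Def. 6] -/
def cubicalSpan : AddSubgroup FormalRep := AddSubgroup.closure cubicalGens

/-- **Cubical move (1b)**: integrand additivity `f = f₁ + f₂` between tame cube classes of the same
dimension. [Kontsevich–Zagier 2001, §1.2 rule (1)] -/
def cubeIntegrandAddRel : Set FormalRep :=
  {c | ∃ (n : ℕ) (r r₁ r₂ : IntegralRep n),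
    r.domain = unitCube n ∧ AnalyticOnNhd ℝ r.integrand (unitCube n) ∧
    r₁.domain = unitCube n ∧ AnalyticOnNhd ℝ r₁.integrand (unitCube n) ∧
    r₂.domain = unitCube n ∧ AnalyticOnNhd ℝ r₂.integrand (unitCube n) ∧
    EqOn r.integrand (r₁.integrand + r₂.integrand) (unitCube n) ∧
    c = of r - of r₁ - of r₂}

/-- **Cubical move (3)**: Newton–Leibniz along the last coordinate of the cube `[0,1]ⁿ⁺¹ → [0,1]ⁿ`,
`∫_{[0,1]ⁿ⁺¹} ∂ₜF = ∫_{[0,1]ⁿ} (F(x,1) − F(x,0))`, for a primitive `F` which is analytic on a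
neighbourhood of the cube, `ℚ`-semialgebraic on it, and has `∂ₜ F = f` on every closed fibre.
[Kontsevich–Zagier 2001, §1.2 rule (3); Ayoub 2014, Def. 6 (Stokes generators)] -/
def cubeNewtonLeibnizRel : Set FormalRep :=
  {c | ∃ (n : ℕ) (r : IntegralRep (n + 1)) (r' : IntegralRep n) (F : (Fin (n + 1) → ℝ) → ℝ),
    r.domain = unitCube (n + 1) ∧ AnalyticOnNhd ℝ r.integrand (unitCube (n + 1)) ∧
    r'.domain = unitCube n ∧ AnalyticOnNhd ℝ r'.integrand (unitCube n) ∧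
    AnalyticOnNhd ℝ F (unitCube (n + 1)) ∧ IsSemialgebraicFunOn ℚ (unitCube (n + 1)) F ∧
    (∀ x ∈ unitCube n, ∀ t ∈ Icc (0 : ℝ) 1,
      HasDerivAt (fun s : ℝ => F (Fin.snoc x s)) (r.integrand (Fin.snoc x t)) t) ∧
    (∀ x ∈ unitCube n, r'.integrand x = F (Fin.snoc x 1) - F (Fin.snoc x 0)) ∧
    c = of r - of r'}

/-- **Cubical move (2)**: change of variables along a `ℚ`-semialgebraic analytic diffeomorphism
`Φ` of the cube onto itself, `∫_{[0,1]ⁿ} f'(Φ x) |det Φ'(x)| = ∫_{[0,1]ⁿ} f'`.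
[Kontsevich–Zagier 2001, §1.2 rule (2)] -/
def cubeChangeOfVariablesRel : Set FormalRep :=
  {c | ∃ (n : ℕ) (r r' : IntegralRep n) (Φ : (Fin n → ℝ) → (Fin n → ℝ))
      (Φ' : (Fin n → ℝ) → ((Fin n → ℝ) →L[ℝ] (Fin n → ℝ))),
    r.domain = unitCube n ∧ AnalyticOnNhd ℝ r.integrand (unitCube n) ∧
    r'.domain = unitCube n ∧ AnalyticOnNhd ℝ r'.integrand (unitCube n) ∧
    IsSemialgebraicMapOn ℚ (unitCube n) Φ ∧
    (∀ x ∈ unitCube n, HasFDerivWithinAt Φ (Φ' x) (unitCube n) x) ∧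
    InjOn Φ (unitCube n) ∧ Φ '' unitCube n = unitCube n ∧
    (∀ i : Fin n, AnalyticOnNhd ℝ (fun x : Fin n → ℝ => Φ x i) (unitCube n)) ∧
    (∀ x ∈ unitCube n, r.integrand x = r'.integrand (Φ x) * |(Φ' x).det|) ∧
    c = of r - of r'}

/-- **Cubical move (1a)**: dyadic halving of the `i`-th coordinate,
`∫_{[0,1]ⁿ} f = ∫_{[0,1]ⁿ} ½ f(…, xᵢ/2, …) + ∫_{[0,1]ⁿ} ½ f(…, (1+xᵢ)/2, …)` (domain additivity
along the null wall `xᵢ = ½` followed by the two affine rescalings of the halves to the cube).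
[Kontsevich–Zagier 2001, §1.2 rules (1), (2)] -/
def cubeHalvingRel : Set FormalRep :=
  {c | ∃ (n : ℕ) (r r₁ r₂ : IntegralRep n) (i : Fin n),
    r.domain = unitCube n ∧ AnalyticOnNhd ℝ r.integrand (unitCube n) ∧
    r₁.domain = unitCube n ∧ AnalyticOnNhd ℝ r₁.integrand (unitCube n) ∧
    r₂.domain = unitCube n ∧ AnalyticOnNhd ℝ r₂.integrand (unitCube n) ∧
    (∀ x ∈ unitCube n, r₁.integrand x = (1 / 2 : ℝ) * r.integrand (Function.update x i (x i / 2))) ∧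
    (∀ x ∈ unitCube n,
      r₂.integrand x = (1 / 2 : ℝ) * r.integrand (Function.update x i ((1 + x i) / 2))) ∧
    c = of r - of r₁ - of r₂}

/-- The four cubical move families together. [Kontsevich–Zagier 2001, §1.2] -/
def cubeMoves : Set FormalRep :=
  cubeIntegrandAddRel ∪ cubeNewtonLeibnizRel ∪ cubeChangeOfVariablesRel ∪ cubeHalvingRel

/-- The subgroup of `KZ.FormalRep` generated by the cubical moves: the relations of the cubical
effective sub-calculus (`A_□ = cubicalSpan ⧸ cubeRelations`). [Kontsevich–Zagier 2001, §1.2] -/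
def cubeRelations : AddSubgroup FormalRep := AddSubgroup.closure cubeMoves

/-- Each cubical move family lies in `cubeMoves`. [folklore] -/
theorem cubeIntegrandAddRel_subset_cubeMoves : cubeIntegrandAddRel ⊆ cubeMoves := fun _ hc =>
  Or.inl (Or.inl (Or.inl hc))

/-- Each cubical move family lies in `cubeMoves`. [folklore] -/
theorem cubeNewtonLeibnizRel_subset_cubeMoves : cubeNewtonLeibnizRel ⊆ cubeMoves := fun _ hc =>
  Or.inl (Or.inl (Or.inr hc))

/-- Each cubical move family lies in `cubeMoves`. [folklore] -/
theorem cubeChangeOfVariablesRel_subset_cubeMoves : cubeChangeOfVariablesRel ⊆ cubeMoves :=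
  fun _ hc => Or.inl (Or.inr hc)

/-- Each cubical move family lies in `cubeMoves`. [folklore] -/
theorem cubeHalvingRel_subset_cubeMoves : cubeHalvingRel ⊆ cubeMoves := fun _ hc => Or.inr hc

/-- Anchor of the definitions file (registered with the skeleton so that this vocabulary file can
land ahead of the stubs that import it): `cubeMoves` is the union of the four cubical families.
[folklore] -/
theorem stub_cubeMoves_def :
    cubeMoves = cubeIntegrandAddRel ∪ cubeNewtonLeibnizRel ∪ cubeChangeOfVariablesRel ∪ cubeHalvingRel :=
  rfl

end Summit.KontsevichZagierPeriods.FurushoPentagon.ReducedPeriodRing
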